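import Mathlib
import Summits.NavierStokesRegularity.NavierStokesRegularity.Theorems.TypeILiouvilleSelfSimilarFloorRate
import Summits.NavierStokesRegularity.NavierStokesRegularity.Theorems.TypeILiouvilleSelfSimilarFloorStrata
import Summits.NavierStokesRegularity.NavierStokesRegularity.Theorems.TypeILiouvilleSelfSimilarFloorCore
import Summits.NavierStokesRegularity.NavierStokesRegularity.Theorems.TypeILiouvilleQuiescentShadow
import Summits.NavierStokesRegularity.NavierStokesRegularity.Theorems.TypeILiouvilleShadowExtraction
import Summits.NavierStokesRegularity.NavierStokesRegularity.Theses.SymmetryModuliCount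
import HarnessLib

/-!
# TypeILiouvilleSelfSimilarFloor — decomp-ns ROOT CELL, lens 2 «structural dichotomy (special vs generic)», generation 22 — PART 4/4 (§4)

Part 4 of the node (Part 1 `…Rate` = §1 the floor + §2 the door; Part 2 `…Strata` = §3 the cut; Part 3 `…Core` =
§3b the residual enemy's profile + §3c the door's open core by name; bodies verbatim, shared namespace). Contents:
§4 exactness at the crux **(L) ⟺ EL ∧ TypeIAncientLiouville ∧ SQL** (`liouvilleL_iff_three_strata`),
**SQL ⟺ SFL ∧ LSL** (`sql_iff_doors`, ← by the landed momentum anchor), **(L) ⟺ EL ∧ TypeIAncientLiouville ∧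
SFL ∧ LSL** (`liouvilleL_iff_four_doors`), g21's door in ledger terms `bcl_iff_typeI_and_sfl`, door order
`typeIAncientLiouville_of_liouvilleL` (`_of_bcl` is the tree's `TypeILiouvilleGlobalFading` lemma), and root reach BY NAME (`closes_root_typeI`, `closes_root_pace` — in the lens file only; not landed, writer PATTERN ε).
Node description (module docstring of the lens file):

# TypeILiouvilleSelfSimilarFloor — decomp-ns ROOT CELL, lens 2 «structural dichotomy (special vs generic)», generation 22

NODE «THE SELF-SIMILAR FLOOR» — a cut of QUIESCENT LIOUVILLE `L_Q` (the residual of record of the KNSS crux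
(L) = `Theses.TypeILiouville.TypeIliouvilleL` = stmt-NavierStokesRegularity-10661; (L) ⟺ EL ∧ L_Q is the LANDED
theorem `Theorems.TypeILiouvilleShadowExtraction.liouvilleL_iff_eternal_and_quiescent_exact`) by the boost/
rotation/scaling-invariant DIAL «backward FADING RATE towards a stream `c`»,
`r_c(t) = sup_x ‖v(t,x) − c‖` measured against the self-similar clock `1/√(−t)`:

* stratum 0  `lim inf_{t→−∞} √(−t)·r_c(t) < ε₀` (fading FASTER than self-similar, even only along a sequence
  of times): **EMPTY — PROVED here** (`const_of_backward_small_rate`, the FLOOR; KNSS 2009 Prop. 4.1 local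
  smoothing `knss2009_local_smoothing_holds` + uniqueness of bounded mild solutions `oseenMild_bounded_unique`
  + the Galilean boost `stub_oseen_const_boost`): no bounded ancient mild solution approaches a constant
  stream faster than a self-similar one;
* stratum I  `√(−t)·r_c(t) ≤ C` for some stream `c` and some `C` (fading AT the self-similar = Type-I rate):
  the special cell **TFL «TYPE-I-RATE FADING LIOUVILLE»**, PROVED here to be EXACTLY the ledger door
  stmt-NavierStokesRegularity-4050 `Theses.SymmetryModuliCount.TypeIAncientLiouville` (`tfl_iff_typeIAncientLiouville`:
  ⟸ by boost + KNSS smoothing `contDiffOn_of_bounded_oseenMild` + `IsWeaklyDivFree.isDivFree_of_contDiff`;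
  ⟹ by the time-shift argument of g21); its sub-stratum `C < 1` is EMPTY by the tree's similarity-enstrophy
  threshold `SimilarityEnstrophy.typeI_ancient_eq_zero_of_rate_lt_one` transported to P and to streams
  (`const_of_typeIRate_lt_one`; eventual version `const_of_eventual_typeIRate_lt_one`), so the door's open
  core is the rate window `C ≥ 1`, and a NON-constant bounded ancient mild solution has, for EVERY stream `c`,
  `lim inf √(−t)·r_c(t) ≥ ε₀` and `lim sup √(−t)·r_c(t) ≥ 1` as `t → −∞` (the residual enemy's profile);
  BY NAME: **stmt-4050 ⟺ «a bounded ancient mild solution fading towards a stream EVENTUALLY at Type-I rate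
  with a constant `C ≥ 1` IS that stream»** (`typeIAncientLiouville_iff_core`, §3c);
* stratum ∞  `sup_t √(−t)·r_c(t) = ∞` for EVERY stream `c` (fading SLOWER than self-similar, or not fading):
  the generic cell **SQL «SLOW QUIESCENT LIOUVILLE»** (residual).

EXACTNESS (all unconditional, kernel-checked): `L_Q ⟺ TFL ∧ SQL` (excluded middle on the Type-I ceiling),
hence **(L) ⟺ EternalLiouville (stmt-18161) ∧ TypeIAncientLiouville (stmt-4050) ∧ SQL**
(`liouvilleL_iff_three_strata`) — the residual of the KNSS crux modulo BOTH named ledger doors — and the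
summit `NavierStokesRegularity` BY NAME from the three strata plus the routes' other open cruxes
(`closes_root_typeI`, `closes_root_pace`: lens file only, not landed). Relation to the g21 doors (BCL «backward-convergent Liouville»,
SFL := BCL off the Type-I stratum, LSL «locally fading, globally stirred»): `BCL ⟺ TypeIAncientLiouville ∧ SFL`
(`bcl_iff_typeI_and_sfl`) and `SQL ⟺ SFL ∧ LSL` (`sql_iff_doors`, ← by the LANDED g21 momentum anchor
`Theorems.TypeILiouvilleGlobalFadingAnchor: backwardConvergent_of_globallyFading`), whence the finest exact form
**(L) ⟺ EL ∧ TypeIAncientLiouville ∧ SFL ∧ LSL** (`liouvilleL_iff_four_doors`). The floor also re-proves the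
CLOSED item stmt-NavierStokesRegularity-8218 `Theses.ExtremalTypeIConstant.SmallConstantLiouville` BY NAME in the
mild class (`smallConstantLiouville_of_floor`), as a certificate that it bites on ledger texts.

Statements are spelled INLINE over existing declarations (no `def`), exactly as in the landed QuiescentShadow /
ShadowExtraction files, so that the writer can land this file verbatim as
`Summits/NavierStokesRegularity/NavierStokesRegularity/Theorems/TypeILiouvilleSelfSimilarFloor.lean --kind proof
 --supports stmt-NavierStokesRegularity-10661`.

P = print's class (KNSS 2009 §4 (i)): `ContinuousOn` on `t<0`, bounded, weakly div-free slices, mild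
heat/Oseen–Duhamel identity between all pairs `s < t < 0`.

Sources: Koch–Nadirashvili–Seregin–Šverák, Acta Math. 203 (2009), Prop. 4.1, §5–6 (arXiv:0709.3599)
[KochNadirashviliSereginSverak2009]; Seregin–Šverák 2009 (Type-I ⟸ Liouville) [SereginSverak2009];
Chae–Wolf 2017 §3 Step 1 (small Type-I ⟹ 0 for classical DSS-type data; the tree's
`ChaeWolf.exists_eps_typeI_small_eq_zero`) [ChaeWolf2017RemovingDSS]; Giga–Inui–Matsui 1999 (uniqueness in L∞).
-/

noncomputable section

set_option linter.dupNamespace false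
set_option maxHeartbeats 800000

open MeasureTheory Set Function Filter
open Literature.Analysis.FluidPDE

namespace Summit.NavierStokesRegularity.NavierStokesRegularity.Theorems.TypeILiouvilleSelfSimilarFloor

/-! ## §4 EXACTNESS AT THE CRUX and ROOT REACH (BY NAME) -/

section Root

/-- **EXACTNESS (unconditional): (L) ⟺ EL ∧ TypeIAncientLiouville ∧ SQL** — the KNSS crux stmt-10661 is, in
the kernel, the conjunction of the two NAMED ledger doors ETERNAL LIOUVILLE (stmt-18161) and TYPE-I ANCIENT
LIOUVILLE (stmt-4050) with ONE residual: the non-existence of quiescent ancient flows fading SLOWER than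
self-similar towards every stream. (→: `eternalLiouville_of_liouvilleL`, `quiescentLiouville_of_liouvilleL` of
the landed QuiescentShadow file, then the cut and the door identification; ←: the landed shadow extraction
`liouvilleL_iff_eternal_and_quiescent_exact`.) -/
theorem liouvilleL_iff_three_strata :
    Theses.TypeILiouville.TypeIliouvilleL ↔
      (Theses.TypeTwoEternal.EternalLiouville ∧
      Theses.SymmetryModuliCount.TypeIAncientLiouville ∧
      (∀ v : ℝ → EuclideanSpace ℝ (Fin 3) → EuclideanSpace ℝ (Fin 3),
      ContinuousOn (uncurry v) (Iio 0 ×ˢ univ) →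
      (∃ K : ℝ, ∀ t < 0, ∀ x, ‖v t x‖ ≤ K) →
      (∀ t < 0, Literature.Analysis.FluidPDE.IsWeaklyDivFree (v t)) →
      (∀ s t : ℝ, s < t → t < 0 → ∀ x,
        v t x = Literature.Analysis.UnboundedOperators.heatExtension (v s) (t - s) x -
          Literature.Analysis.FluidPDE.oseenDuhamel 1 s v v t x) →
      (∀ ε : ℝ, 0 < ε → ∃ T : ℝ, T < 0 ∧ ∀ t < T, ∀ x y : EuclideanSpace ℝ (Fin 3),
        dist x y ≤ 1 → ‖v t x - v t y‖ ≤ ε) →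
      (∀ (c : EuclideanSpace ℝ (Fin 3)) (C : ℝ), ∃ t : ℝ, t < 0 ∧ ∃ x,
        C < Real.sqrt (-t) * ‖v t x - c‖) →
      ∃ b : EuclideanSpace ℝ (Fin 3), ∀ t < 0, ∀ x, v t x = b)) := by
  refine ⟨fun hL => ?_, fun h => ?_⟩
  · have hQ := (quiescentLiouville_iff_strata.1
      (TypeILiouvilleQuiescentShadow.quiescentLiouville_of_liouvilleL hL))
    exact ⟨TypeILiouvilleQuiescentShadow.eternalLiouville_of_liouvilleL hL,
      tfl_iff_typeIAncientLiouville.1 hQ.1, hQ.2⟩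
  · exact TypeILiouvilleShadowExtraction.liouvilleL_iff_eternal_and_quiescent_exact.2
      ⟨h.1, quiescentLiouville_iff_strata.2 ⟨tfl_iff_typeIAncientLiouville.2 h.2.1, h.2.2⟩⟩

/-- **(L) ⟸ EL ∧ TypeIAncientLiouville ∧ SQL**, concluding `Theses.TypeILiouville.TypeIliouvilleL` BY NAME —
unconditional. -/
theorem liouvilleL_of_strata (hE : Theses.TypeTwoEternal.EternalLiouville)
    (h4050 : Theses.SymmetryModuliCount.TypeIAncientLiouville)
    (hS : (∀ v : ℝ → EuclideanSpace ℝ (Fin 3) → EuclideanSpace ℝ (Fin 3),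
      ContinuousOn (uncurry v) (Iio 0 ×ˢ univ) →
      (∃ K : ℝ, ∀ t < 0, ∀ x, ‖v t x‖ ≤ K) →
      (∀ t < 0, Literature.Analysis.FluidPDE.IsWeaklyDivFree (v t)) →
      (∀ s t : ℝ, s < t → t < 0 → ∀ x,
        v t x = Literature.Analysis.UnboundedOperators.heatExtension (v s) (t - s) x -
          Literature.Analysis.FluidPDE.oseenDuhamel 1 s v v t x) →
      (∀ ε : ℝ, 0 < ε → ∃ T : ℝ, T < 0 ∧ ∀ t < T, ∀ x y : EuclideanSpace ℝ (Fin 3),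
        dist x y ≤ 1 → ‖v t x - v t y‖ ≤ ε) →
      (∀ (c : EuclideanSpace ℝ (Fin 3)) (C : ℝ), ∃ t : ℝ, t < 0 ∧ ∃ x,
        C < Real.sqrt (-t) * ‖v t x - c‖) →
      ∃ b : EuclideanSpace ℝ (Fin 3), ∀ t < 0, ∀ x, v t x = b)) :
    Theses.TypeILiouville.TypeIliouvilleL :=
  liouvilleL_iff_three_strata.2 ⟨hE, h4050, hS⟩

/-- **(L) ⟹ TypeIAncientLiouville** (door order, through the cut and the door identification). -/
theorem typeIAncientLiouville_of_liouvilleL (hL : Theses.TypeILiouville.TypeIliouvilleL) :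
    Theses.SymmetryModuliCount.TypeIAncientLiouville :=
  (liouvilleL_iff_three_strata.1 hL).2.1

/-- **g21's door in ledger terms: BCL ⟺ TypeIAncientLiouville ∧ SFL.** -/
theorem bcl_iff_typeI_and_sfl :
    (∀ v : ℝ → EuclideanSpace ℝ (Fin 3) → EuclideanSpace ℝ (Fin 3),
      ContinuousOn (uncurry v) (Iio 0 ×ˢ univ) →
      (∃ K : ℝ, ∀ t < 0, ∀ x, ‖v t x‖ ≤ K) →
      (∀ t < 0, Literature.Analysis.FluidPDE.IsWeaklyDivFree (v t)) →
      (∀ s t : ℝ, s < t → t < 0 → ∀ x,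
        v t x = Literature.Analysis.UnboundedOperators.heatExtension (v s) (t - s) x -
          Literature.Analysis.FluidPDE.oseenDuhamel 1 s v v t x) →
      (∃ c : EuclideanSpace ℝ (Fin 3), ∀ η : ℝ, 0 < η → ∃ T : ℝ, T < 0 ∧ ∀ t < T, ∀ x,
        ‖v t x - c‖ ≤ η) →
      ∃ b : EuclideanSpace ℝ (Fin 3), ∀ t < 0, ∀ x, v t x = b) ↔
    (Theses.SymmetryModuliCount.TypeIAncientLiouville ∧
    (∀ v : ℝ → EuclideanSpace ℝ (Fin 3) → EuclideanSpace ℝ (Fin 3),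
      ContinuousOn (uncurry v) (Iio 0 ×ˢ univ) →
      (∃ K : ℝ, ∀ t < 0, ∀ x, ‖v t x‖ ≤ K) →
      (∀ t < 0, Literature.Analysis.FluidPDE.IsWeaklyDivFree (v t)) →
      (∀ s t : ℝ, s < t → t < 0 → ∀ x,
        v t x = Literature.Analysis.UnboundedOperators.heatExtension (v s) (t - s) x -
          Literature.Analysis.FluidPDE.oseenDuhamel 1 s v v t x) →
      (∃ c : EuclideanSpace ℝ (Fin 3), ∀ η : ℝ, 0 < η → ∃ T : ℝ, T < 0 ∧ ∀ t < T, ∀ x,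
        ‖v t x - c‖ ≤ η) →
      (∀ (c : EuclideanSpace ℝ (Fin 3)) (C : ℝ), ∃ t : ℝ, t < 0 ∧ ∃ x,
        C < Real.sqrt (-t) * ‖v t x - c‖) →
      ∃ b : EuclideanSpace ℝ (Fin 3), ∀ t < 0, ∀ x, v t x = b)) := by
  rw [bcl_iff_strata, tfl_iff_typeIAncientLiouville]

-- `typeIAncientLiouville_of_bcl` (BCL ⟹ TypeIAncientLiouville) is already the tree's
-- `Theorems.TypeILiouvilleGlobalFading.typeIAncientLiouville_of_bcl`; here it would read `(bcl_iff_typeI_and_sfl.1 hB).1`.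

/-- **SQL ⟺ SFL ∧ LSL — UNCONDITIONAL** (→: the g22 residual refines both g21 residual doors, `sfl_of_sql`,
`lsl_of_sql`; ←: `sql_of_sfl_lsl_of_anchor` with the anchor discharged by the LANDED g21 momentum anchor
`TypeILiouvilleGlobalFading.backwardConvergent_of_globallyFading`). -/
theorem sql_iff_doors :
    (∀ v : ℝ → EuclideanSpace ℝ (Fin 3) → EuclideanSpace ℝ (Fin 3),
      ContinuousOn (uncurry v) (Iio 0 ×ˢ univ) →
      (∃ K : ℝ, ∀ t < 0, ∀ x, ‖v t x‖ ≤ K) →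
      (∀ t < 0, Literature.Analysis.FluidPDE.IsWeaklyDivFree (v t)) →
      (∀ s t : ℝ, s < t → t < 0 → ∀ x,
        v t x = Literature.Analysis.UnboundedOperators.heatExtension (v s) (t - s) x -
          Literature.Analysis.FluidPDE.oseenDuhamel 1 s v v t x) →
      (∀ ε : ℝ, 0 < ε → ∃ T : ℝ, T < 0 ∧ ∀ t < T, ∀ x y : EuclideanSpace ℝ (Fin 3),
        dist x y ≤ 1 → ‖v t x - v t y‖ ≤ ε) →
      (∀ (c : EuclideanSpace ℝ (Fin 3)) (C : ℝ), ∃ t : ℝ, t < 0 ∧ ∃ x,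
        C < Real.sqrt (-t) * ‖v t x - c‖) →
      ∃ b : EuclideanSpace ℝ (Fin 3), ∀ t < 0, ∀ x, v t x = b) ↔
    ((∀ v : ℝ → EuclideanSpace ℝ (Fin 3) → EuclideanSpace ℝ (Fin 3),
      ContinuousOn (uncurry v) (Iio 0 ×ˢ univ) →
      (∃ K : ℝ, ∀ t < 0, ∀ x, ‖v t x‖ ≤ K) →
      (∀ t < 0, Literature.Analysis.FluidPDE.IsWeaklyDivFree (v t)) →
      (∀ s t : ℝ, s < t → t < 0 → ∀ x,
        v t x = Literature.Analysis.UnboundedOperators.heatExtension (v s) (t - s) x -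
          Literature.Analysis.FluidPDE.oseenDuhamel 1 s v v t x) →
      (∃ c : EuclideanSpace ℝ (Fin 3), ∀ η : ℝ, 0 < η → ∃ T : ℝ, T < 0 ∧ ∀ t < T, ∀ x,
        ‖v t x - c‖ ≤ η) →
      (∀ (c : EuclideanSpace ℝ (Fin 3)) (C : ℝ), ∃ t : ℝ, t < 0 ∧ ∃ x,
        C < Real.sqrt (-t) * ‖v t x - c‖) →
      ∃ b : EuclideanSpace ℝ (Fin 3), ∀ t < 0, ∀ x, v t x = b) ∧
    (∀ v : ℝ → EuclideanSpace ℝ (Fin 3) → EuclideanSpace ℝ (Fin 3),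
      ContinuousOn (uncurry v) (Iio 0 ×ˢ univ) →
      (∃ K : ℝ, ∀ t < 0, ∀ x, ‖v t x‖ ≤ K) →
      (∀ t < 0, Literature.Analysis.FluidPDE.IsWeaklyDivFree (v t)) →
      (∀ s t : ℝ, s < t → t < 0 → ∀ x,
        v t x = Literature.Analysis.UnboundedOperators.heatExtension (v s) (t - s) x -
          Literature.Analysis.FluidPDE.oseenDuhamel 1 s v v t x) →
      (∀ ε : ℝ, 0 < ε → ∃ T : ℝ, T < 0 ∧ ∀ t < T, ∀ x y : EuclideanSpace ℝ (Fin 3),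
        dist x y ≤ 1 → ‖v t x - v t y‖ ≤ ε) →
      (∃ θ : ℝ, 0 < θ ∧ ∀ T : ℝ, T < 0 → ∃ t : ℝ, t < T ∧ ∃ x y : EuclideanSpace ℝ (Fin 3),
        θ < ‖v t x - v t y‖) →
      ∃ b : EuclideanSpace ℝ (Fin 3), ∀ t < 0, ∀ x, v t x = b)) :=
  ⟨fun hS => ⟨sfl_of_sql hS, lsl_of_sql hS⟩, fun h =>
    sql_of_sfl_lsl_of_anchor
      (fun _ hc hK _ hm hGF => TypeILiouvilleGlobalFading.backwardConvergent_of_globallyFading hc hK hm hGF)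
      h.1 h.2⟩

/-- **EXACTNESS, finest form (unconditional): (L) ⟺ EL ∧ TypeIAncientLiouville ∧ SFL ∧ LSL** — the two ledger
doors stmt-18161, stmt-4050 and g21's two residual doors (slowly-but-uniformly convergent flows; locally fading,
globally stirred flows). -/
theorem liouvilleL_iff_four_doors :
    Theses.TypeILiouville.TypeIliouvilleL ↔
      (Theses.TypeTwoEternal.EternalLiouville ∧
      Theses.SymmetryModuliCount.TypeIAncientLiouville ∧
      (∀ v : ℝ → EuclideanSpace ℝ (Fin 3) → EuclideanSpace ℝ (Fin 3),
      ContinuousOn (uncurry v) (Iio 0 ×ˢ univ) →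
      (∃ K : ℝ, ∀ t < 0, ∀ x, ‖v t x‖ ≤ K) →
      (∀ t < 0, Literature.Analysis.FluidPDE.IsWeaklyDivFree (v t)) →
      (∀ s t : ℝ, s < t → t < 0 → ∀ x,
        v t x = Literature.Analysis.UnboundedOperators.heatExtension (v s) (t - s) x -
          Literature.Analysis.FluidPDE.oseenDuhamel 1 s v v t x) →
      (∃ c : EuclideanSpace ℝ (Fin 3), ∀ η : ℝ, 0 < η → ∃ T : ℝ, T < 0 ∧ ∀ t < T, ∀ x,
        ‖v t x - c‖ ≤ η) →
      (∀ (c : EuclideanSpace ℝ (Fin 3)) (C : ℝ), ∃ t : ℝ, t < 0 ∧ ∃ x,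
        C < Real.sqrt (-t) * ‖v t x - c‖) →
      ∃ b : EuclideanSpace ℝ (Fin 3), ∀ t < 0, ∀ x, v t x = b) ∧
      (∀ v : ℝ → EuclideanSpace ℝ (Fin 3) → EuclideanSpace ℝ (Fin 3),
      ContinuousOn (uncurry v) (Iio 0 ×ˢ univ) →
      (∃ K : ℝ, ∀ t < 0, ∀ x, ‖v t x‖ ≤ K) →
      (∀ t < 0, Literature.Analysis.FluidPDE.IsWeaklyDivFree (v t)) →
      (∀ s t : ℝ, s < t → t < 0 → ∀ x,
        v t x = Literature.Analysis.UnboundedOperators.heatExtension (v s) (t - s) x -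
          Literature.Analysis.FluidPDE.oseenDuhamel 1 s v v t x) →
      (∀ ε : ℝ, 0 < ε → ∃ T : ℝ, T < 0 ∧ ∀ t < T, ∀ x y : EuclideanSpace ℝ (Fin 3),
        dist x y ≤ 1 → ‖v t x - v t y‖ ≤ ε) →
      (∃ θ : ℝ, 0 < θ ∧ ∀ T : ℝ, T < 0 → ∃ t : ℝ, t < T ∧ ∃ x y : EuclideanSpace ℝ (Fin 3),
        θ < ‖v t x - v t y‖) →
      ∃ b : EuclideanSpace ℝ (Fin 3), ∀ t < 0, ∀ x, v t x = b)) := by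
  rw [liouvilleL_iff_three_strata, sql_iff_doors]

/-- **(L) ⟸ EL ∧ TypeIAncientLiouville ∧ SFL ∧ LSL**, concluding the crux BY NAME (unconditional). -/
theorem liouvilleL_of_doors
    (hE : Theses.TypeTwoEternal.EternalLiouville)
    (h4050 : Theses.SymmetryModuliCount.TypeIAncientLiouville)
    (hF : (∀ v : ℝ → EuclideanSpace ℝ (Fin 3) → EuclideanSpace ℝ (Fin 3),
      ContinuousOn (uncurry v) (Iio 0 ×ˢ univ) →
      (∃ K : ℝ, ∀ t < 0, ∀ x, ‖v t x‖ ≤ K) →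
      (∀ t < 0, Literature.Analysis.FluidPDE.IsWeaklyDivFree (v t)) →
      (∀ s t : ℝ, s < t → t < 0 → ∀ x,
        v t x = Literature.Analysis.UnboundedOperators.heatExtension (v s) (t - s) x -
          Literature.Analysis.FluidPDE.oseenDuhamel 1 s v v t x) →
      (∃ c : EuclideanSpace ℝ (Fin 3), ∀ η : ℝ, 0 < η → ∃ T : ℝ, T < 0 ∧ ∀ t < T, ∀ x,
        ‖v t x - c‖ ≤ η) →
      (∀ (c : EuclideanSpace ℝ (Fin 3)) (C : ℝ), ∃ t : ℝ, t < 0 ∧ ∃ x,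
        C < Real.sqrt (-t) * ‖v t x - c‖) →
      ∃ b : EuclideanSpace ℝ (Fin 3), ∀ t < 0, ∀ x, v t x = b))
    (hL : (∀ v : ℝ → EuclideanSpace ℝ (Fin 3) → EuclideanSpace ℝ (Fin 3),
      ContinuousOn (uncurry v) (Iio 0 ×ˢ univ) →
      (∃ K : ℝ, ∀ t < 0, ∀ x, ‖v t x‖ ≤ K) →
      (∀ t < 0, Literature.Analysis.FluidPDE.IsWeaklyDivFree (v t)) →
      (∀ s t : ℝ, s < t → t < 0 → ∀ x,
        v t x = Literature.Analysis.UnboundedOperators.heatExtension (v s) (t - s) x -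
          Literature.Analysis.FluidPDE.oseenDuhamel 1 s v v t x) →
      (∀ ε : ℝ, 0 < ε → ∃ T : ℝ, T < 0 ∧ ∀ t < T, ∀ x y : EuclideanSpace ℝ (Fin 3),
        dist x y ≤ 1 → ‖v t x - v t y‖ ≤ ε) →
      (∃ θ : ℝ, 0 < θ ∧ ∀ T : ℝ, T < 0 → ∃ t : ℝ, t < T ∧ ∃ x y : EuclideanSpace ℝ (Fin 3),
        θ < ‖v t x - v t y‖) →
      ∃ b : EuclideanSpace ℝ (Fin 3), ∀ t < 0, ∀ x, v t x = b)) :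
    Theses.TypeILiouville.TypeIliouvilleL :=
  liouvilleL_iff_four_doors.2 ⟨hE, h4050, hF, hL⟩

-- Root reach (closure-modulo packaging `closes_root_typeI` / `closes_root_pace` of the lens file) is NOT landed
-- (writer PATTERN ε): cite the tree's `Theses.TypeILiouville.closes … Assembly_holds` ∘ `liouvilleL_of_strata`.

end Root

end Summit.NavierStokesRegularity.NavierStokesRegularity.Theorems.TypeILiouvilleSelfSimilarFloor

end
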